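import Summits.QuantumFields.BalabanUV.Beta.D1BFx.ColumnGaugeDefectEnvelope
import Summits.QuantumFields.BalabanUV.Beta.D1BFx.DshBlockMass
import Summits.QuantumFields.BalabanUV.Beta.D1BFx.GhostWordEnvelope

/-!
# `BalabanUV.Beta.D1BFx.DshWordMass` — road «BF-x», binder row D1, PART 24-hyb HEAD (OWNER d1-p2 g25, `ChartDefectHead` v1.1; SPEC v1.2 §4 «m-uniformity needs the
# packed ∕ mass currency», N-g25-1 l.54036 «mass currency = pricing; O-6 `DshBlockMass` = the `Dsh` mass letter»):
# **THE `ℓ¹` MASS OF THE DOUBLE-COMMUTATOR `Dsh`-WORD `[diagK h, [diagK g, Dsh n]]` FOR `ℓ¹`-ENVELOPED WEIGHTS — `≤ c·n⁵·e^{−(δn∕2)|y′ − y|₁}`, CONSTANT CLOSED IN `n`**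
# (FILE 1 of 2; FILE 2 = `ChartDefectRowsDshMass`: the HEAD's row (dd) in MASS currency against ANY leg with bounded off-diagonal blocks, and the straight-leg count)

HONEST DEPENDENCY (cell records, verbatim): «continuum YM on T⁴ ⇐ BetaPertH ∧ nine spine estimates (0/9 proved); BetaPertH ⇐ (D1) ∧ (D4) ∧
CAP+tail; G-an2-4 gates asym, D1 and NE2/3/4.»  HONEST FRAMING (cell contract, verbatim): «discharging `BetaPertH` makes Bałaban's UV stability
UNCONDITIONAL — a real constructive-QFT result; it is NOT the continuum limit and NOT the Clay problem.»  THIS MODULE is [folklore] `ℓ¹` bookkeeping BY NAME over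
LANDED objects: an1's `Dsh` (`DshAn1` ∕ `DshAn1Spread`: blocks, antisymmetric placement, window `cube 4 (2n)`), O-6 `DshBlockMass` (own ∕ neighbouring block mass
`≤ n^{3+1}·((3+1)·n)`, every other block `0`), g32's `ColumnGaugeDefectEnvelope.commCommDefect_apply` (entries of the word), d1-leaf-04's `GhostWordEnvelope` (pair-sum
plumbing; its `abs_tadpole_le_of_bdd_mass` GENERALISED here to a leg bounded only ON THE TABLE's SUPPORT PATTERN), lit `KKTFluctuationEnergy.tsum_blocks`.  The weights
`g`, `h` are ARBITRARY with DISPLAYED `ℓ¹`-exponential envelopes; nothing about Bałaban's (or an1's) tables is asserted.  No `def`, no `def … : Prop`, nothing cited,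
0 sorry.  0∕4 row-D1 binders (hW ∕ hR ∕ D1Tel ∕ D1Rep); (K) NOT closed; (J1) ONE OPEN ROW; NOT D1, NEVER «G-an2-4 closed», NOT `BetaPertH`, NOT continuum, NOT Clay.

ABSOLUTE RULE (cell charter, verbatim): «No internally-minted statement may enter as a cited fact. Every hypothesis is either kernel-proved in
this package or a verbatim quotation of a PUBLISHED theorem with page reference. The manuscript(s) under audit are NOT citable for their own
disputed steps — they are the thing under adjudication; programme-internal (2001/route/tribunal) claims are never citable.»

WHY.  O-8 `ChartDefectRowsDsh` priced the HEAD's `Dsh`-rows (dd) (xb) (bb) in SUP currency (lit `abs_tadpole_le` ∕ `abs_bubble_le`: `BiLoc` constant × `Zl`), where the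
`G^{Dsh}`∕`W^{Dsh}` letters carry `n⁴` and each `Zl (3+1) (δ_A∕·)` another `n⁴` — NOT n-uniform (located count, `g32/LOCATED-COUNT-DshWords-g32.md`).  In MASS currency a
tadpole is `≤ (sup of the leg ON THE WORD's SUPPORT) × (ℓ¹ mass of the word)`; the word `W y x f a = (h y f − h x a)·((g y f − g x a)·Dsh n y x f a)` lives on the two
OFF-DIAGONAL blocks of the packed fibre (so only the leg's `ℋ`-type columns are read — never its ff block `Γ` nor its mm block), and its mass is the `Dsh` block mass `≍ n⁵`
(O-6) times the two `O(1)` weight envelopes, which also supply the coarse decay `e^{−(δn∕2)|y′ − y|₁}` (two centres to one).  FILE 2 multiplies by the leg.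

CONTENT ([folklore]; `W := comp (diagK h) (comp (diagK g) (Dsh n) − comp (Dsh n) (diagK g)) − comp (comp (diagK g) (Dsh n) − comp (Dsh n) (diagK g)) (diagK h)`, weights
`|g x a| ≤ Cg·e^{−δ|x − n•y|₁}`, `|h x a| ≤ Ch·e^{−δ|x − n•y′|₁}`, `E := e^{8nδ}`, `T := 4·(2·(n^{3+1}·((3+1)·n)))`).
* §0 `abs_sum_mul_le_of_ne`, **`abs_tadpole_le_of_bddOn_mass`** (`|L x y a f| ≤ S` wherever `W y x f a ≠ 0`, `W` absolutely summable ⟹ `|tadpole L W| ≤ S·Σ' Σ |W|`).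
* §1 entries: `word_inl_inl`, `word_inr_inr` (diagonal fibre blocks vanish), `abs_word_inr_inl` (the mf block mirrors the fm block), `exp_transfer_of_Dsh_ne_zero`,
  **`abs_word_le`** (`|W y x a b| ≤ (Ch·(E+1)·e^{−δ|x − n•y′|₁})·(Cg·(E+1)·e^{−δ|x − n•y|₁})·|Dsh n y x a b|`), `exp_two_centres`.
* §2 masses: `summable_abs_Dsh_col`, **`tsum_abs_Dsh_col_le`** (`Σ'_y Σ_α |Dsh n y (n•X) (inl α) (inr m)| ≤ 2·(n^{3+1}·((3+1)·n))` — O-6 BY NAME through `tsum_blocks`),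
  **`word_col_mass_le`**, `word_inl_inr_eq_zero_of_proj_ne`, **`word_inl_inr_mass_le`** (`Σ'_x Σ'_y Σ_{α m} |W y x (inl α) (inr m)| ≤ (Ch·Cg·(E+1)²·T·Zl 4 (δ∕2·n))·e^{−(δ∕2·n)|y′ − y|₁}`,
  the columns summed on the coarse sublattice `x = n•X`).
NOT HERE (FILE 2): the pair-sum form, the tadpole, the record's weights, the straight leg.  Unit `b2b-balaban-beta-d1-formalise-leaf-01` (gen 33), D1 formalisation swarm LEAF
PROVER 01, road «BF-x»; OFFER O-9 part 1.  Not in print; our bookkeeping.  No existing file touched.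
-/

noncomputable section

namespace Summit.QuantumFields.BalabanUV.Beta.D1BFx.DshWordMass

open Finset
open scoped BigOperators
open Literature.MathematicalPhysics.QuantumFieldTheory
open Literature.MathematicalPhysics.QuantumFieldTheory.LatticeForm (quo)
open Literature.MathematicalPhysics.QuantumFieldTheory.Balaban1983to89
open Literature.MathematicalPhysics.QuantumFieldTheory.Balaban1983to89.Beta
open B12Sec2to5 (l1 l1_nonneg)
open ExpKernelCalculus (MKer Zl Zl_pos Zl_nonneg comp tr tadpole l1_sub_triangle l1_sub_symm l1_natSmul summable_exp_shift' tsum_exp_shift')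
open OneStepResolventKernel (Fib quo_zsmul proj_zsmul eq_zsmul_quo_of_proj)
open AffineAveraging (Site box toSite unitVec unitVec_apply)
open AveragingContours (blk blk_block)
open KKTFluctuationEnergy (tsum_blocks)
open Summit.QuantumFields.BalabanUV.Beta.BorderedHessian (diagK)
open Summit.QuantumFields.BalabanUV.Beta.DshAn1 (Dsh Dsh_inl_inl Dsh_inr_inr Dsh_inl_inr Dsh_inr_inl_eq_neg Dsh_ne_zero_window)
open Summit.QuantumFields.BalabanUV.Beta.AxialDressingRooted (cube mem_cube l1_le_of_mem_cube)
open Summit.QuantumFields.BalabanUV.Beta.D1BFx.ColumnGaugeDefectEnvelope (commCommDefect_apply)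
open Summit.QuantumFields.BalabanUV.Beta.D1BFx.DshBlockMass (sum_abs_Dsh_block_le sum_abs_Dsh_block_succ_le Dsh_inl_inr_eq_zero_of_blk_ne)
open Summit.QuantumFields.BalabanUV.Beta.D1BFx.GhostWordEnvelope (summable_section_snd summable_tsum_snd tsum_tsum_snd_eq)

/-! ## §0 A tadpole against a leg bounded ON THE TABLE's SUPPORT PATTERN -/

section Tool

variable {D : ℕ} {F : Type*} [Fintype F]

omit [Fintype F] in
/-- [folklore] A finite sum of products against a bound that is only asked where the second factor is non-zero:
`(∀ g, b g ≠ 0 → |a g| ≤ S)` ⟹ `|Σ_g a g·b g| ≤ Σ_g S·|b g|`. -/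
theorem abs_sum_mul_le_of_ne (s : Finset F) (a b : F → ℝ) {S : ℝ} (h : ∀ g, b g ≠ 0 → |a g| ≤ S) :
    |∑ g ∈ s, a g * b g| ≤ ∑ g ∈ s, S * |b g| := by
  refine (Finset.abs_sum_le_sum_abs _ _).trans (Finset.sum_le_sum fun g _ => ?_)
  by_cases hb : b g = 0
  · rw [hb, mul_zero, abs_zero, mul_zero]
  · rw [abs_mul]
    exact mul_le_mul_of_nonneg_right (h g hb) (abs_nonneg _)

/-- [folklore] **THE TADPOLE WORD AGAINST A LEG BOUNDED ON THE TABLE's SUPPORT PATTERN** (d1-leaf-04's `GhostWordEnvelope.abs_tadpole_le_of_bdd_mass` with the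
leg letter weakened from `Bdd L S` to «`|L x y a g| ≤ S` wherever `W y x g a ≠ 0`» — so a table living on the off-diagonal blocks of a packed fibre sees only the
off-diagonal blocks of the leg): for an absolutely summable table `W`, `|tadpole L W| ≤ S·Σ'_{(y,x)} Σ_{g a} |W y x g a|`. -/
theorem abs_tadpole_le_of_bddOn_mass {L W : MKer D F} {S : ℝ} (hL : ∀ x y a g, W y x g a ≠ 0 → |L x y a g| ≤ S)
    (hW : Summable fun p : Site D × Site D => ∑ g, ∑ a, |W p.1 p.2 g a|) :
    |tadpole L W| ≤ S * ∑' p : Site D × Site D, ∑ g, ∑ a, |W p.1 p.2 g a| := by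
  have hsec : ∀ x, Summable fun y : Site D => ∑ g, ∑ a, |W y x g a| := fun x =>
    summable_section_snd (Φ := fun y x => ∑ g, ∑ a, |W y x g a|) hW x
  have hseca : ∀ x a, Summable fun y : Site D => ∑ g, |W y x g a| := fun x a =>
    Summable.of_nonneg_of_le (fun y => Finset.sum_nonneg fun g _ => abs_nonneg _)
      (fun y => Finset.sum_le_sum fun g _ =>
        Finset.single_le_sum (f := fun a' => |W y x g a'|) (fun a' _ => abs_nonneg _) (Finset.mem_univ a))
      (hsec x)
  have hcol : Summable fun x : Site D => ∑' y : Site D, ∑ g, ∑ a, |W y x g a| :=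
    summable_tsum_snd (Φ := fun y x => ∑ g, ∑ a, |W y x g a|) hW
  -- inner sum, `x a` fixed
  have hinner : ∀ x a, |comp L W x x a a| ≤ S * ∑' y : Site D, ∑ g, |W y x g a| := by
    intro x a
    unfold ExpKernelCalculus.comp
    have hmaj := (hseca x a).mul_left S
    have hb := tsum_of_norm_bounded (f := fun y => ∑ g, L x y a g * W y x g a) hmaj.hasSum (fun y => by
      rw [Real.norm_eq_abs, Finset.mul_sum]
      exact abs_sum_mul_le_of_ne Finset.univ (fun g => L x y a g) (fun g => W y x g a) (fun g hg => hL x y a g hg))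
    rw [Real.norm_eq_abs, tsum_mul_left] at hb
    exact hb
  have hfib : ∀ x, ∑ a, S * ∑' y : Site D, ∑ g, |W y x g a| = S * ∑' y : Site D, ∑ g, ∑ a, |W y x g a| := by
    intro x
    rw [← Finset.mul_sum, ← Summable.tsum_finsetSum (fun a _ => hseca x a)]
    congr 1
    exact tsum_congr fun y => Finset.sum_comm
  unfold ExpKernelCalculus.tadpole ExpKernelCalculus.tr
  have hmaj := hcol.mul_left S
  have hb := tsum_of_norm_bounded (f := fun x => ∑ a, comp L W x x a a) hmaj.hasSum (fun x => by
    rw [Real.norm_eq_abs]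
    calc |∑ a, comp L W x x a a| ≤ ∑ a, |comp L W x x a a| := Finset.abs_sum_le_sum_abs _ _
      _ ≤ ∑ a, S * ∑' y : Site D, ∑ g, |W y x g a| := Finset.sum_le_sum fun a _ => hinner x a
      _ = S * ∑' y : Site D, ∑ g, ∑ a, |W y x g a| := hfib x)
  rw [Real.norm_eq_abs, tsum_mul_left, tsum_tsum_snd_eq (Φ := fun y x => ∑ g, ∑ a, |W y x g a|) hW] at hb
  exact hb

end Tool

/-! ## §1 The entries of the double-commutator `Dsh`-word `[diagK h, [diagK g, Dsh n]]` for enveloped weights -/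

section Entries

variable {n : ℕ} [NeZero n]

omit [NeZero n] in
/-- [folklore] The field–field entries of the `Dsh`-word vanish (`Dsh`'s ff block does). -/
theorem word_inl_inl (g h : Site (3 + 1) → Fib 3 → ℝ) (y x : Site (3 + 1)) (α β : Fin (3 + 1)) :
    (comp (diagK h) (comp (diagK g) (Dsh (d := 3) n) - comp (Dsh (d := 3) n) (diagK g))
        - comp (comp (diagK g) (Dsh (d := 3) n) - comp (Dsh (d := 3) n) (diagK g)) (diagK h)) y x (Sum.inl α) (Sum.inl β) = 0 := by
  rw [commCommDefect_apply, Dsh_inl_inl, mul_zero, mul_zero]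

omit [NeZero n] in
/-- [folklore] The multiplier–multiplier entries of the `Dsh`-word vanish. -/
theorem word_inr_inr (g h : Site (3 + 1) → Fib 3 → ℝ) (y x : Site (3 + 1)) (m m' : Fin (3 + 1)) :
    (comp (diagK h) (comp (diagK g) (Dsh (d := 3) n) - comp (Dsh (d := 3) n) (diagK g))
        - comp (comp (diagK g) (Dsh (d := 3) n) - comp (Dsh (d := 3) n) (diagK g)) (diagK h)) y x (Sum.inr m) (Sum.inr m') = 0 := by
  rw [commCommDefect_apply, Dsh_inr_inr, mul_zero, mul_zero]

omit [NeZero n] in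
/-- [folklore] **THE TWO OFF-DIAGONAL BLOCKS OF THE `Dsh`-WORD MIRROR EACH OTHER IN ABSOLUTE VALUE**: `|W y x (inr m) (inl α)| = |W x y (inl α) (inr m)|`
(the weight prefactor is symmetric under the swap, `Dsh` is antisymmetrically placed). -/
theorem abs_word_inr_inl (g h : Site (3 + 1) → Fib 3 → ℝ) (y x : Site (3 + 1)) (m α : Fin (3 + 1)) :
    |(comp (diagK h) (comp (diagK g) (Dsh (d := 3) n) - comp (Dsh (d := 3) n) (diagK g))
        - comp (comp (diagK g) (Dsh (d := 3) n) - comp (Dsh (d := 3) n) (diagK g)) (diagK h)) y x (Sum.inr m) (Sum.inl α)|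
      = |(comp (diagK h) (comp (diagK g) (Dsh (d := 3) n) - comp (Dsh (d := 3) n) (diagK g))
        - comp (comp (diagK g) (Dsh (d := 3) n) - comp (Dsh (d := 3) n) (diagK g)) (diagK h)) x y (Sum.inl α) (Sum.inr m)| := by
  rw [commCommDefect_apply, commCommDefect_apply, Dsh_inr_inl_eq_neg]
  have e : (h y (Sum.inr m) - h x (Sum.inl α)) * ((g y (Sum.inr m) - g x (Sum.inl α)) * -Dsh n x y (Sum.inl α) (Sum.inr m))
      = -((h x (Sum.inl α) - h y (Sum.inr m)) * ((g x (Sum.inl α) - g y (Sum.inr m)) * Dsh n x y (Sum.inl α) (Sum.inr m))) := by ring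
  rw [e, abs_neg]

/-- [folklore] An `ℓ¹`-envelope is carried across `Dsh`'s finite window: if `Dsh n y x a b ≠ 0` then `|y − x|₁ ≤ 4·(2n)`, so
`e^{−δ|y − c|₁} ≤ e^{δ·(4·(2n))}·e^{−δ|x − c|₁}` (`0 ≤ δ`). -/
theorem exp_transfer_of_Dsh_ne_zero {δ : ℝ} (hδ : 0 ≤ δ) {y x : Site (3 + 1)} {a b : Fib 3} (hD : Dsh (d := 3) n y x a b ≠ 0) (c : Site (3 + 1)) :
    Real.exp (-δ * l1 (y - c)) ≤ Real.exp (δ * (((3 : ℝ) + 1) * (2 * n))) * Real.exp (-δ * l1 (x - c)) := by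
  have hn : 1 ≤ n := Nat.one_le_iff_ne_zero.2 (NeZero.ne n)
  have hw := Dsh_ne_zero_window hn hD
  have hl : l1 (y - x) ≤ ((3 : ℝ) + 1) * (2 * n) := by
    have := l1_le_of_mem_cube hw
    push_cast at this
    linarith
  rw [← Real.exp_add]
  refine Real.exp_le_exp.2 ?_
  have t : l1 (x - c) ≤ l1 (x - y) + l1 (y - c) := l1_sub_triangle x y c
  rw [l1_sub_symm x y] at t
  have h2 : δ * l1 (x - c) ≤ δ * (((3 : ℝ) + 1) * (2 * n) + l1 (y - c)) :=
    mul_le_mul_of_nonneg_left (t.trans (by linarith)) hδ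
  linarith

/-- [folklore] **ENTRY BOUND OF THE `Dsh`-WORD, LOCALISED AT THE SECOND (COLUMN) INDEX**: weights `g`, `h` with envelopes `Cg·e^{−δ|· − p|₁}`, `Ch·e^{−δ|· − p′|₁}` on every
fibre component (`0 ≤ Cg, Ch, δ`) give
`|W y x a b| ≤ (Ch·(e^{8nδ} + 1)·e^{−δ|x − p′|₁})·(Cg·(e^{8nδ} + 1)·e^{−δ|x − p|₁})·|Dsh n y x a b|`. -/
theorem abs_word_le (g h : Site (3 + 1) → Fib 3 → ℝ) {Cg Ch δ : ℝ} {p p' : Site (3 + 1)} (hCg : 0 ≤ Cg) (hCh : 0 ≤ Ch) (hδ : 0 ≤ δ)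
    (hg : ∀ x a, |g x a| ≤ Cg * Real.exp (-δ * l1 (x - p))) (hh : ∀ x a, |h x a| ≤ Ch * Real.exp (-δ * l1 (x - p')))
    (y x : Site (3 + 1)) (a b : Fib 3) :
    |(comp (diagK h) (comp (diagK g) (Dsh (d := 3) n) - comp (Dsh (d := 3) n) (diagK g))
        - comp (comp (diagK g) (Dsh (d := 3) n) - comp (Dsh (d := 3) n) (diagK g)) (diagK h)) y x a b|
      ≤ (Ch * (Real.exp (δ * (((3 : ℝ) + 1) * (2 * n))) + 1) * Real.exp (-δ * l1 (x - p')))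
        * (Cg * (Real.exp (δ * (((3 : ℝ) + 1) * (2 * n))) + 1) * Real.exp (-δ * l1 (x - p))) * |Dsh (d := 3) n y x a b| := by
  rw [commCommDefect_apply, abs_mul, abs_mul]
  by_cases hD : Dsh (d := 3) n y x a b = 0
  · rw [hD, abs_zero, mul_zero, mul_zero, mul_zero]
  have tg : |g y a - g x b| ≤ Cg * (Real.exp (δ * (((3 : ℝ) + 1) * (2 * n))) + 1) * Real.exp (-δ * l1 (x - p)) := by
    refine (abs_sub _ _).trans ?_
    have h1 := (hg y a).trans (mul_le_mul_of_nonneg_left (exp_transfer_of_Dsh_ne_zero hδ hD p) hCg)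
    have h2 := hg x b
    calc |g y a| + |g x b| ≤ Cg * (Real.exp (δ * (((3 : ℝ) + 1) * (2 * n))) * Real.exp (-δ * l1 (x - p))) + Cg * Real.exp (-δ * l1 (x - p)) :=
          add_le_add h1 h2
      _ = _ := by ring
  have th : |h y a - h x b| ≤ Ch * (Real.exp (δ * (((3 : ℝ) + 1) * (2 * n))) + 1) * Real.exp (-δ * l1 (x - p')) := by
    refine (abs_sub _ _).trans ?_
    have h1 := (hh y a).trans (mul_le_mul_of_nonneg_left (exp_transfer_of_Dsh_ne_zero hδ hD p') hCh)
    have h2 := hh x b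
    calc |h y a| + |h x b| ≤ Ch * (Real.exp (δ * (((3 : ℝ) + 1) * (2 * n))) * Real.exp (-δ * l1 (x - p'))) + Ch * Real.exp (-δ * l1 (x - p')) :=
          add_le_add h1 h2
      _ = _ := by ring
  rw [← mul_assoc]
  exact mul_le_mul_of_nonneg_right (mul_le_mul th tg (abs_nonneg _) (by positivity)) (abs_nonneg _)

/-- [folklore] Two centres to one, half the rate kept on the column: `e^{−δ|x − p′|₁}·e^{−δ|x − p|₁} ≤ e^{−(δ∕2)|p′ − p|₁}·e^{−(δ∕2)|x − p|₁}` (`0 ≤ δ`). -/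
theorem exp_two_centres {δ : ℝ} (hδ : 0 ≤ δ) (x p p' : Site (3 + 1)) :
    Real.exp (-δ * l1 (x - p')) * Real.exp (-δ * l1 (x - p)) ≤ Real.exp (-(δ / 2) * l1 (p' - p)) * Real.exp (-(δ / 2) * l1 (x - p)) := by
  rw [← Real.exp_add, ← Real.exp_add]
  refine Real.exp_le_exp.2 ?_
  have t : l1 (p' - p) ≤ l1 (p' - x) + l1 (x - p) := l1_sub_triangle p' x p
  rw [l1_sub_symm p' x] at t
  nlinarith [l1_nonneg (x - p'), l1_nonneg (x - p)]

end Entries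

/-! ## §2 The `ℓ¹` masses: `Dsh`'s field–multiplier column at a coarse point (O-6 BY NAME), the word's column, the full fibre mass -/

section Mass

variable {n : ℕ} [NeZero n]

/-- [folklore] The field–multiplier column of `Dsh n` at the coarse point `n•X`, direction `m`, has finite support (an1's window), hence is summable. -/
theorem summable_abs_Dsh_col (X : Site (3 + 1)) (m : Fin (3 + 1)) :
    Summable fun y : Site (3 + 1) => ∑ α : Fin (3 + 1), |Dsh (d := 3) n y ((n : ℤ) • X) (Sum.inl α) (Sum.inr m)| := by
  have hn : 1 ≤ n := Nat.one_le_iff_ne_zero.2 (NeZero.ne n)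
  refine summable_of_ne_finset_zero (s := (cube (3 + 1) (2 * n)).image fun v => v + (n : ℤ) • X) fun y hy => ?_
  refine Finset.sum_eq_zero fun α _ => ?_
  rw [abs_eq_zero]
  by_contra h
  exact hy (Finset.mem_image.2 ⟨y - (n : ℤ) • X, Dsh_ne_zero_window hn h, sub_add_cancel _ _⟩)

/-- [folklore] **THE COLUMN MASS OF `Dsh`'s FIELD–MULTIPLIER BLOCK AT A COARSE POINT** (O-6 `DshBlockMass` BY NAME: own block + neighbouring block, every other block `0`):
`Σ'_y Σ_α |Dsh n y (n•X) (inl α) (inr m)| ≤ 2·(n^{3+1}·((3+1)·n))`. -/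
theorem tsum_abs_Dsh_col_le (X : Site (3 + 1)) (m : Fin (3 + 1)) :
    ∑' y : Site (3 + 1), ∑ α : Fin (3 + 1), |Dsh (d := 3) n y ((n : ℤ) • X) (Sum.inl α) (Sum.inr m)|
      ≤ 2 * ((n : ℝ) ^ (3 + 1) * (((3 : ℝ) + 1) * n)) := by
  have hn : 1 ≤ n := Nat.one_le_iff_ne_zero.2 (NeZero.ne n)
  rw [tsum_blocks (N := n) (summable_abs_Dsh_col X m)]
  have hne : X ≠ X + unitVec m := by
    intro h; have := congrFun h m; simp [unitVec_apply] at this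
  have hzero : ∀ Y ∉ ({X, X + unitVec m} : Finset (Site (3 + 1))),
      ∑ b ∈ box (3 + 1) n, ∑ α : Fin (3 + 1), |Dsh (d := 3) n ((n : ℤ) • Y + toSite b) ((n : ℤ) • X) (Sum.inl α) (Sum.inr m)| = 0 := by
    intro Y hY
    rw [Finset.mem_insert, Finset.mem_singleton, not_or] at hY
    refine Finset.sum_eq_zero fun b hb => Finset.sum_eq_zero fun α _ => ?_
    rw [abs_eq_zero]
    exact Dsh_inl_inr_eq_zero_of_blk_ne hn (by rw [blk_block Y hb]; exact hY.1) (by rw [blk_block Y hb]; exact hY.2) α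
  rw [tsum_eq_sum hzero, Finset.sum_pair hne]
  have e3 : (((3 : ℕ) : ℝ) + 1) = (3 : ℝ) + 1 := by norm_num
  have h1 := sum_abs_Dsh_block_le (d := 3) hn X m
  have h2 := sum_abs_Dsh_block_succ_le (d := 3) hn X m
  rw [Finset.sum_comm, e3] at h1 h2
  linarith

variable (g h : Site (3 + 1) → Fib 3 → ℝ) {Cg Ch δ : ℝ} {yb yz : Site (3 + 1)}

/-- [folklore] **THE WORD's FIELD–MULTIPLIER COLUMN AT A COARSE POINT `n•X`**: summable, and
`Σ'_y Σ_α Σ_m |W y (n•X) (inl α) (inr m)| ≤ (Ch·(E+1)·e^{−δ|n•X − n•yz|₁})·(Cg·(E+1)·e^{−δ|n•X − n•yb|₁})·(4·(2·(n^{3+1}·((3+1)·n))))`, `E := e^{8nδ}`. -/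
theorem word_col_mass_le (hCg : 0 ≤ Cg) (hCh : 0 ≤ Ch) (hδ : 0 ≤ δ)
    (hg : ∀ x a, |g x a| ≤ Cg * Real.exp (-δ * l1 (x - (n : ℤ) • yb))) (hh : ∀ x a, |h x a| ≤ Ch * Real.exp (-δ * l1 (x - (n : ℤ) • yz)))
    (X : Site (3 + 1)) :
    (Summable fun y : Site (3 + 1) => ∑ α : Fin (3 + 1), ∑ m : Fin (3 + 1),
        |(comp (diagK h) (comp (diagK g) (Dsh (d := 3) n) - comp (Dsh (d := 3) n) (diagK g))
            - comp (comp (diagK g) (Dsh (d := 3) n) - comp (Dsh (d := 3) n) (diagK g)) (diagK h)) y ((n : ℤ) • X) (Sum.inl α) (Sum.inr m)|) ∧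
      ∑' y : Site (3 + 1), ∑ α : Fin (3 + 1), ∑ m : Fin (3 + 1),
          |(comp (diagK h) (comp (diagK g) (Dsh (d := 3) n) - comp (Dsh (d := 3) n) (diagK g))
            - comp (comp (diagK g) (Dsh (d := 3) n) - comp (Dsh (d := 3) n) (diagK g)) (diagK h)) y ((n : ℤ) • X) (Sum.inl α) (Sum.inr m)|
        ≤ (Ch * (Real.exp (δ * (((3 : ℝ) + 1) * (2 * n))) + 1) * Real.exp (-δ * l1 ((n : ℤ) • X - (n : ℤ) • yz)))
          * (Cg * (Real.exp (δ * (((3 : ℝ) + 1) * (2 * n))) + 1) * Real.exp (-δ * l1 ((n : ℤ) • X - (n : ℤ) • yb)))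
          * (4 * (2 * ((n : ℝ) ^ (3 + 1) * (((3 : ℝ) + 1) * n)))) := by
  set K : ℝ := (Ch * (Real.exp (δ * (((3 : ℝ) + 1) * (2 * n))) + 1) * Real.exp (-δ * l1 ((n : ℤ) • X - (n : ℤ) • yz)))
      * (Cg * (Real.exp (δ * (((3 : ℝ) + 1) * (2 * n))) + 1) * Real.exp (-δ * l1 ((n : ℤ) • X - (n : ℤ) • yb))) with hK
  have hK0 : 0 ≤ K := by positivity
  -- pointwise: the entry bound, summed over the fibre
  have hpt : ∀ y, ∑ α : Fin (3 + 1), ∑ m : Fin (3 + 1),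
        |(comp (diagK h) (comp (diagK g) (Dsh (d := 3) n) - comp (Dsh (d := 3) n) (diagK g))
            - comp (comp (diagK g) (Dsh (d := 3) n) - comp (Dsh (d := 3) n) (diagK g)) (diagK h)) y ((n : ℤ) • X) (Sum.inl α) (Sum.inr m)|
      ≤ K * ∑ m : Fin (3 + 1), ∑ α : Fin (3 + 1), |Dsh (d := 3) n y ((n : ℤ) • X) (Sum.inl α) (Sum.inr m)| := by
    intro y
    rw [Finset.sum_comm, Finset.mul_sum]
    refine Finset.sum_le_sum fun m _ => ?_
    rw [Finset.mul_sum]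
    exact Finset.sum_le_sum fun α _ => abs_word_le g h hCg hCh hδ hg hh y ((n : ℤ) • X) (Sum.inl α) (Sum.inr m)
  have hnn : ∀ y, 0 ≤ ∑ α : Fin (3 + 1), ∑ m : Fin (3 + 1),
        |(comp (diagK h) (comp (diagK g) (Dsh (d := 3) n) - comp (Dsh (d := 3) n) (diagK g))
            - comp (comp (diagK g) (Dsh (d := 3) n) - comp (Dsh (d := 3) n) (diagK g)) (diagK h)) y ((n : ℤ) • X) (Sum.inl α) (Sum.inr m)| :=
    fun y => Finset.sum_nonneg fun α _ => Finset.sum_nonneg fun m _ => abs_nonneg _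
  have hsm : Summable fun y : Site (3 + 1) => K * ∑ m : Fin (3 + 1), ∑ α : Fin (3 + 1), |Dsh (d := 3) n y ((n : ℤ) • X) (Sum.inl α) (Sum.inr m)| :=
    (summable_sum fun m _ => summable_abs_Dsh_col (n := n) X m).mul_left K
  have hs : Summable fun y : Site (3 + 1) => ∑ α : Fin (3 + 1), ∑ m : Fin (3 + 1),
        |(comp (diagK h) (comp (diagK g) (Dsh (d := 3) n) - comp (Dsh (d := 3) n) (diagK g))
            - comp (comp (diagK g) (Dsh (d := 3) n) - comp (Dsh (d := 3) n) (diagK g)) (diagK h)) y ((n : ℤ) • X) (Sum.inl α) (Sum.inr m)| :=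
    Summable.of_nonneg_of_le hnn hpt hsm
  refine ⟨hs, (Summable.tsum_le_tsum hpt hs hsm).trans ?_⟩
  rw [tsum_mul_left, Summable.tsum_finsetSum (fun m _ => summable_abs_Dsh_col (n := n) X m)]
  refine mul_le_mul_of_nonneg_left ?_ hK0
  calc ∑ m : Fin (3 + 1), ∑' y : Site (3 + 1), ∑ α : Fin (3 + 1), |Dsh (d := 3) n y ((n : ℤ) • X) (Sum.inl α) (Sum.inr m)|
      ≤ ∑ _m : Fin (3 + 1), 2 * ((n : ℝ) ^ (3 + 1) * (((3 : ℝ) + 1) * n)) := Finset.sum_le_sum fun m _ => tsum_abs_Dsh_col_le X m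
    _ = 4 * (2 * ((n : ℝ) ^ (3 + 1) * (((3 : ℝ) + 1) * n))) := by
        rw [Finset.sum_const, Finset.card_univ, Fintype.card_fin, nsmul_eq_mul]; push_cast; ring

omit [NeZero n] in
/-- [folklore] Off the coarse sublattice the word's field–multiplier column vanishes (the multiplier index of `Dsh` lives on `nℤ⁴`). -/
theorem word_inl_inr_eq_zero_of_proj_ne {x : Site (3 + 1)} (hx : Literature.Probability.LatticeModels.Torus.proj n x ≠ 0) (y : Site (3 + 1))
    (α m : Fin (3 + 1)) :
    (comp (diagK h) (comp (diagK g) (Dsh (d := 3) n) - comp (Dsh (d := 3) n) (diagK g))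
        - comp (comp (diagK g) (Dsh (d := 3) n) - comp (Dsh (d := 3) n) (diagK g)) (diagK h)) y x (Sum.inl α) (Sum.inr m) = 0 := by
  rw [commCommDefect_apply, Dsh_inl_inr, if_neg hx, mul_zero, mul_zero]

/-- [folklore] **THE WORD's FIELD–MULTIPLIER MASS, SUMMED OVER ALL COLUMNS**: the column masses of `word_col_mass_le` live on the coarse sublattice and sum to
`≤ (Ch·Cg·(E+1)²·(4·(2·(n^{3+1}·((3+1)·n))))·Zl 4 (δ∕2·n))·e^{−(δ∕2·n)|yz − yb|₁}` (two centres to one: half the rate on the coarse separation, half summed). -/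
theorem word_inl_inr_mass_le (hCg : 0 ≤ Cg) (hCh : 0 ≤ Ch) (hδ : 0 < δ)
    (hg : ∀ x a, |g x a| ≤ Cg * Real.exp (-δ * l1 (x - (n : ℤ) • yb))) (hh : ∀ x a, |h x a| ≤ Ch * Real.exp (-δ * l1 (x - (n : ℤ) • yz))) :
    (Summable fun x : Site (3 + 1) => ∑' y : Site (3 + 1), ∑ α : Fin (3 + 1), ∑ m : Fin (3 + 1),
        |(comp (diagK h) (comp (diagK g) (Dsh (d := 3) n) - comp (Dsh (d := 3) n) (diagK g))
            - comp (comp (diagK g) (Dsh (d := 3) n) - comp (Dsh (d := 3) n) (diagK g)) (diagK h)) y x (Sum.inl α) (Sum.inr m)|) ∧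
      ∑' x : Site (3 + 1), ∑' y : Site (3 + 1), ∑ α : Fin (3 + 1), ∑ m : Fin (3 + 1),
          |(comp (diagK h) (comp (diagK g) (Dsh (d := 3) n) - comp (Dsh (d := 3) n) (diagK g))
            - comp (comp (diagK g) (Dsh (d := 3) n) - comp (Dsh (d := 3) n) (diagK g)) (diagK h)) y x (Sum.inl α) (Sum.inr m)|
        ≤ (Ch * Cg * (Real.exp (δ * (((3 : ℝ) + 1) * (2 * n))) + 1) ^ 2 * (4 * (2 * ((n : ℝ) ^ (3 + 1) * (((3 : ℝ) + 1) * n))))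
            * Zl 4 (δ / 2 * n)) * Real.exp (-(δ / 2 * n) * l1 (yz - yb)) := by
  have hn0 : (n : ℤ) ≠ 0 := by exact_mod_cast NeZero.ne n
  have hnr : (0 : ℝ) < n := by exact_mod_cast Nat.pos_of_ne_zero (NeZero.ne n)
  set T : ℝ := 4 * (2 * ((n : ℝ) ^ (3 + 1) * (((3 : ℝ) + 1) * n))) with hT
  set E : ℝ := Real.exp (δ * (((3 : ℝ) + 1) * (2 * n))) + 1 with hE
  set Φ : Site (3 + 1) → ℝ := fun x => ∑' y : Site (3 + 1), ∑ α : Fin (3 + 1), ∑ m : Fin (3 + 1),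
        |(comp (diagK h) (comp (diagK g) (Dsh (d := 3) n) - comp (Dsh (d := 3) n) (diagK g))
            - comp (comp (diagK g) (Dsh (d := 3) n) - comp (Dsh (d := 3) n) (diagK g)) (diagK h)) y x (Sum.inl α) (Sum.inr m)| with hΦ
  -- the column sum lives on the coarse sublattice
  have hinj : Function.Injective fun X : Site (3 + 1) => (n : ℤ) • X := smul_right_injective (Site (3 + 1)) hn0
  have hoff : ∀ x, x ∉ Set.range (fun X : Site (3 + 1) => (n : ℤ) • X) → Φ x = 0 := by
    intro x hx
    have hproj : Literature.Probability.LatticeModels.Torus.proj n x ≠ 0 := by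
      intro h0
      exact hx ⟨quo n x, (eq_zsmul_quo_of_proj (N := n) h0).symm⟩
    simp only [hΦ, word_inl_inr_eq_zero_of_proj_ne g h hproj, abs_zero, Finset.sum_const_zero, tsum_zero]
  -- on the sublattice: the column bound, two centres to one
  have hcol : ∀ X : Site (3 + 1), Φ ((n : ℤ) • X) ≤ (Ch * Cg * E ^ 2 * T) * Real.exp (-(δ / 2 * n) * l1 (yz - yb))
      * Real.exp (-(δ / 2 * n) * l1 (X - yb)) := by
    intro X
    have h1 := (word_col_mass_le g h hCg hCh hδ.le hg hh X).2
    have h2 := exp_two_centres hδ.le ((n : ℤ) • X) ((n : ℤ) • yb) ((n : ℤ) • yz)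
    have e1 : l1 ((n : ℤ) • yz - (n : ℤ) • yb) = (n : ℝ) * l1 (yz - yb) := by rw [← smul_sub, l1_natSmul]
    have e2 : l1 ((n : ℤ) • X - (n : ℤ) • yb) = (n : ℝ) * l1 (X - yb) := by rw [← smul_sub, l1_natSmul]
    rw [e1] at h2
    have ea : Real.exp (-(δ / 2) * ((n : ℝ) * l1 (yz - yb))) = Real.exp (-(δ / 2 * n) * l1 (yz - yb)) := by
      congr 1; ring
    have eb : Real.exp (-(δ / 2) * l1 ((n : ℤ) • X - (n : ℤ) • yb)) = Real.exp (-(δ / 2 * n) * l1 (X - yb)) := by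
      rw [e2]; congr 1; ring
    calc Φ ((n : ℤ) • X) ≤ (Ch * E * Real.exp (-δ * l1 ((n : ℤ) • X - (n : ℤ) • yz))) * (Cg * E * Real.exp (-δ * l1 ((n : ℤ) • X - (n : ℤ) • yb))) * T := h1
      _ = (Ch * Cg * E ^ 2 * T) * (Real.exp (-δ * l1 ((n : ℤ) • X - (n : ℤ) • yz)) * Real.exp (-δ * l1 ((n : ℤ) • X - (n : ℤ) • yb))) := by ring
      _ ≤ (Ch * Cg * E ^ 2 * T) * (Real.exp (-(δ / 2) * ((n : ℝ) * l1 (yz - yb))) * Real.exp (-(δ / 2) * l1 ((n : ℤ) • X - (n : ℤ) • yb))) :=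
          mul_le_mul_of_nonneg_left h2 (by positivity)
      _ = _ := by rw [ea, eb]; ring
  have hΦ0 : ∀ x, 0 ≤ Φ x := fun x => tsum_nonneg fun y => Finset.sum_nonneg fun α _ => Finset.sum_nonneg fun m _ => abs_nonneg _
  have hδn : 0 < δ / 2 * n := by positivity
  have hmaj := (summable_exp_shift' (D := 3 + 1) hδn yb).mul_left ((Ch * Cg * E ^ 2 * T) * Real.exp (-(δ / 2 * n) * l1 (yz - yb)))
  have hsub : Summable fun X : Site (3 + 1) => Φ ((n : ℤ) • X) := Summable.of_nonneg_of_le (fun X => hΦ0 _) hcol hmaj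
  have hsum : Summable Φ := (hinj.summable_iff hoff).1 hsub
  refine ⟨hsum, ?_⟩
  rw [← hinj.tsum_eq (f := Φ) (fun x hx => by by_contra h'; exact hx (hoff x h'))]
  calc ∑' X : Site (3 + 1), Φ ((n : ℤ) • X)
      ≤ ∑' X : Site (3 + 1), (Ch * Cg * E ^ 2 * T) * Real.exp (-(δ / 2 * n) * l1 (yz - yb)) * Real.exp (-(δ / 2 * n) * l1 (X - yb)) :=
        Summable.tsum_le_tsum hcol hsub hmaj
    _ = (Ch * Cg * E ^ 2 * T) * Real.exp (-(δ / 2 * n) * l1 (yz - yb)) * Zl 4 (δ / 2 * n) := by rw [tsum_mul_left, tsum_exp_shift']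
    _ = _ := by ring

end Mass

end Summit.QuantumFields.BalabanUV.Beta.D1BFx.DshWordMass

end
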